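import Summits.BirchSwinnertonDyer.Rank1Residual.O5.O5TransferCertificate
import HarnessLib

/-!
# O5 @ 3 — the Selmer transfer certificate T27: the typed realisation node is EQUIVALENT to T27 (audit), and the
# LOCAL-ALGEBRA cores of the lane's lemmas L2 / L3 / L4 (cell `b2b-bsdres`, lane CLASS-CLOSURE §3.5, team O5; filed by
# seat x11b3-p3 GEN 15 as a cross-cell POOL item on the O5 lane's BY-NAME invitation A-O5-25 (o5-r1 GEN 14, G14-6) and
# x11b3-lead GEN 16's deal R17-5 / `WAKE-T1.md`; THEOREMS ONLY; the O5 lane's reading governs; x11b3 books nothing)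

HONEST FRAMING (cell `b2b-bsdres`, verbatim in every file): the goal of the cell is to DELETE the COMBINATION-SHAPED
residual classes of the Birch–Swinnerton-Dyer formula for ALL analytic-rank `≤ 1` elliptic curves over `ℚ` — "full BSD
formula for every rank `≤ 1` curve in class `C`" assembled STRICTLY from published theorems — so that the rank-`≤ 1`
remainder becomes exactly the CONSTRUCTION-SHAPED classes, which are TYPED (missing-input `Prop`s), NOT attempted. This is
not "finishing BSD". Lane CLASS-CLOSURE: census output is EVIDENCE / conjecture items, never a Literature fact; nothing is
booked; no mark of `RESIDUAL-MAP.md` moves; O5 stays OPEN. THIS FILE: pure linear algebra / finite-group counting; 0 `def`s,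
0 Literature facts, 0 `@[conjecture]`, 0 `_holds` of any O5 node, no `sorry`; nothing about any curve or class is asserted.

## §A (AUDIT of the typing — x11b3-lead GEN 16 R17-5 (b), kernel-confirmed here). AS TYPED, the realisation node
`O5.SelmerPairRealisedThree` (`O5/O5TransferCertificate.lean` §3, p303410 / restamp p309865) asks for an ABSTRACT
`SelmerTransfer.TransferDatum (ZMod 3)` — all fields `ι H L loc X Y S` free — with prescribed `dimX`, `dimY` and budgets
`≤ crudeBudgetThree W G`. Such a datum exists as soon as the two numerical inequalities of T27 hold (nested coordinate
subspaces: `ι := Unit`, `H := 𝔽₃^{min} × 𝔽₃^{|a−b|}`, `loc := id`, the smaller condition `range inl`, the larger `⊤`,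
`S := univ`; budgets `0` and `|a − b|`), so **`SelmerPairRealisedThree ↔ CrudeSelmerTransferThree`**
(`selmerPairRealisedThree_iff_crudeSelmerTransferThree`; `→` is the landed `crudeSelmerTransferThree_of_realised`).
CONSEQUENCE (the lead's typing note, for cc-typer-5 / o5-r1 — THEIR pen): the node as typed carries NO local-cohomology
content; a re-typed realisation node (global space `H¹(ℚ, ρ̄)`, Kummer conditions) is the typer's decision. Nothing here
proves or discharges T27 / T27-REAL: both remain `@[conjecture]` obligations exactly as landed.

## §B (the LOCAL LEMMAS L2 / L3 / L4 of T27-REAL's docstring as ALGEBRAIC CORES — TOOL / [folklore] theorems, kernel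
neighbours for the lane's CLASSICAL proof; they discharge NOTHING of the node as typed). DICTIONARY (the arithmetic
reading is the O5 lane's, NOT claimed here; `M = ρ̄ = W[3]` as a `G_{ℚ_ℓ}`-module, `φ` = Frobenius, `ℓ ≠ 3`):
* L3(ii) 'dim H¹_ur(ℚ_ℓ, M) = dim H⁰(ℚ_ℓ, M) = h⁰_ℓ' (`H¹_ur = M/(φ−1)M`, `H⁰ = M^{φ=1} = ker(φ−1)`): for ANY endomorphism
  `g` of a FINITE abelian group, `#ker g = #(M ⧸ g M)` (`addMonoidHom_natCard_ker_eq_natCard_quotient_range`, with `g = φ − 1`: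
  `natCard_fixedBy_eq_natCard_coinvariants`); `finrank` form over any division ring (`finrank_ker_eq_finrank_quotient_range`).
* L2 'dim W(ℚ₃)/3 = 1 + h⁰₃': the FINITE part is the same count with `g = 3` (`#(T/3T) = #T[3]`,
  `natCard_quotient_nsmul_eq_natCard_torsionBy`); the free part `ℤ₃` contributes `#(ℤ₃/3ℤ₃) = 3`, `ℤ₃[3] = 0`
  (`natCard_padicInt_quotient_three`, `nsmul_three_ker_padicInt_eq_bot`), assembled as `#(A/3A) = 3·#A[3]` for
  `A = ℤ₃ × T` (`natCard_quotient_three_padicInt_prod`); the decomposition `W(ℚ₃) ≅ ℤ₃ ⊕ W(ℚ₃)_tors` (formal logarithm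
  on `Ŵ(3ℤ₃)`, `e = 1 < p − 1`) is the lane's reading and is NOT claimed.
* L3(i) 'dim X_ℓ/(X_ℓ ∩ H¹_ur) ≤ [3 ∣ c_ℓ]' (`U` = image of `W₀(ℚ_ℓ)/3 ⊆ H¹_ur = V` since `W₀(ℚ_ℓ^ur)` is 3-divisible,
  `X` = image of `W(ℚ_ℓ)/3`, `x` = the Kummer class of a generator of the CYCLIC 3-part of `Φ_ℓ(𝔽_ℓ)`): quotienting by a
  LARGER subspace only lowers the codimension count (`finrank_map_mkQ_anti`), and ONE extra generator costs at most one
  dimension (`finrank_map_mkQ_le_one_of_le_sup_span`); if `3 ∤ c_ℓ` then `X ≤ U ≤ V` and the count is `0`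
  (the landed `finrank_map_mkQ_eq_zero_of_le`); and 'dim X_ℓ = h⁰_ℓ' = `#(A/3A) = #A[3]` for `A = B × T`, `3` bijective
  on `B`, `T` finite (`natCard_quotient_nsmul_prod_of_bijective`; `W(ℚ_ℓ) ≅ B ⊕ tors`, `B` pro-`ℓ`, is the lane's reading).
* L4 'X_ℓ = Y_ℓ at a shared SPLIT node with h⁰_ℓ = 1' (Tate curves `W`, `G` with the same `ρ̄`: both Kummer lines are the
  image of `H¹(ℚ_ℓ, μ₃) → H¹(ℚ_ℓ, ρ̄)`, a line through the toric class; `H¹(ℚ_ℓ, ρ̄)` is a hyperbolic plane,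
  `hyperbolicPlaneThree_isotropic_card`): two LINES meeting non-trivially coincide (`eq_of_finrank_eq_one_of_inf_ne_bot`).
References: [MazurRubin2015SelmerCompanions] §2, §7.3, Lemma 20/23 (arXiv:1203.0620); [PoonenRains2012] Prop. 4.11–4.13;
[SilvermanATAEC1994] IV Cor. 9.2 (cyclic 3-part of `Φ`), V.5.3 (Tate curve); Milne ADT I.2.6. Cell files:
`HOME/b2b-bsdres-o5-r1/gen10/T27-TRANSFER-CERTIFICATE.md` §1–§2, `cells/o5o6/TARGETS.md` (G14-6), `cells/x11b3/OWNERS.md` R17-5.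
-/

noncomputable section

open scoped Classical

open Module

namespace Summit.BirchSwinnertonDyer.Rank1Residual.O5

namespace SelmerTransfer

/-! ## §A The realisation node AS TYPED is equivalent to T27 (nested coordinate datum) -/

section Audit

variable {F : Type} [Field F]

/-- With one place and the identity localisation, the Selmer group of the constant condition `X` is `X` itself. [folklore] -/
theorem selmerOf_unit_id {H : Type} [AddCommGroup H] [Module F H] (X : Submodule F H) :
    selmerOf (fun _ : Unit => (LinearMap.id : H →ₗ[F] H)) (fun _ => X) = X := by
  ext c
  simp [mem_selmerOf_iff]

/-- `dim (⊤ / X) = dim H − dim X`, rendered as the image of `⊤` in `H ⧸ X`. [folklore] -/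
theorem finrank_map_top_mkQ {H : Type} [AddCommGroup H] [Module F H] [FiniteDimensional F H] (X : Submodule F H) :
    finrank F ((⊤ : Submodule F H).map X.mkQ) + finrank F X = finrank F H := by
  rw [Submodule.map_top, Submodule.range_mkQ, finrank_top]
  exact Submodule.finrank_quotient_add_finrank X

/-- **Nested datum, small `X`**: for all `a e` there is a transfer datum over `F` with `dim Sel_X = a`, `dim Sel_Y = a + e`,
`budgetXY = 0`, `budgetYX = e` (`H = F^a × F^e`, `X = F^a × 0`, `Y = ⊤`, one place, `loc = id`). [folklore] -/
theorem exists_transferDatum_small_large (a e : ℕ) :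
    ∃ 𝓓 : TransferDatum F, 𝓓.dimX = a ∧ 𝓓.dimY = a + e ∧ 𝓓.budgetXY = 0 ∧ 𝓓.budgetYX = e := by
  let A := Fin a → F
  let E := Fin e → F
  let Xs : Submodule F (A × E) := LinearMap.range (LinearMap.inl F A E)
  have hXs : finrank F Xs = a := by
    rw [LinearMap.finrank_range_of_inj LinearMap.inl_injective, Module.finrank_fin_fun]
  have hH : finrank F (A × E) = a + e := by
    rw [Module.finrank_prod, Module.finrank_fin_fun, Module.finrank_fin_fun]
  refine ⟨{ ι := Unit, H := A × E, L := fun _ => A × E, loc := fun _ => LinearMap.id, X := fun _ => Xs,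
            Y := fun _ => ⊤, S := Finset.univ, agree := fun v hv => (hv (Finset.mem_univ v)).elim }, ?_, ?_, ?_, ?_⟩
  · show finrank F (selmerOf (fun _ : Unit => (LinearMap.id : A × E →ₗ[F] A × E)) (fun _ => Xs)) = a
    rw [selmerOf_unit_id, hXs]
  · show finrank F (selmerOf (fun _ : Unit => (LinearMap.id : A × E →ₗ[F] A × E)) (fun _ => (⊤ : Submodule F (A × E))))
        = a + e
    rw [selmerOf_unit_id, finrank_top, hH]
  · show ∑ v ∈ (Finset.univ : Finset Unit), finrank F (Xs.map (⊤ : Submodule F (A × E)).mkQ) = 0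
    rw [finrank_map_mkQ_eq_zero_of_le le_top, Finset.sum_const_zero]
  · show ∑ v ∈ (Finset.univ : Finset Unit), finrank F ((⊤ : Submodule F (A × E)).map Xs.mkQ) = e
    have h := finrank_map_top_mkQ (F := F) Xs
    rw [hXs, hH] at h
    rw [Finset.sum_const, Finset.card_univ, Fintype.card_unit, one_smul]
    omega

/-- **Nested datum, large `X`**: the same with the roles of `X` and `Y` exchanged — `dim Sel_X = a + e`, `dim Sel_Y = a`,
`budgetXY = e`, `budgetYX = 0`. [folklore] -/
theorem exists_transferDatum_large_small (a e : ℕ) :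
    ∃ 𝓓 : TransferDatum F, 𝓓.dimX = a + e ∧ 𝓓.dimY = a ∧ 𝓓.budgetXY = e ∧ 𝓓.budgetYX = 0 := by
  let A := Fin a → F
  let E := Fin e → F
  let Xs : Submodule F (A × E) := LinearMap.range (LinearMap.inl F A E)
  have hXs : finrank F Xs = a := by
    rw [LinearMap.finrank_range_of_inj LinearMap.inl_injective, Module.finrank_fin_fun]
  have hH : finrank F (A × E) = a + e := by
    rw [Module.finrank_prod, Module.finrank_fin_fun, Module.finrank_fin_fun]
  refine ⟨{ ι := Unit, H := A × E, L := fun _ => A × E, loc := fun _ => LinearMap.id, X := fun _ => ⊤,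
            Y := fun _ => Xs, S := Finset.univ, agree := fun v hv => (hv (Finset.mem_univ v)).elim }, ?_, ?_, ?_, ?_⟩
  · show finrank F (selmerOf (fun _ : Unit => (LinearMap.id : A × E →ₗ[F] A × E)) (fun _ => (⊤ : Submodule F (A × E))))
        = a + e
    rw [selmerOf_unit_id, finrank_top, hH]
  · show finrank F (selmerOf (fun _ : Unit => (LinearMap.id : A × E →ₗ[F] A × E)) (fun _ => Xs)) = a
    rw [selmerOf_unit_id, hXs]
  · show ∑ v ∈ (Finset.univ : Finset Unit), finrank F ((⊤ : Submodule F (A × E)).map Xs.mkQ) = e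
    have h := finrank_map_top_mkQ (F := F) Xs
    rw [hXs, hH] at h
    rw [Finset.sum_const, Finset.card_univ, Fintype.card_unit, one_smul]
    omega
  · show ∑ v ∈ (Finset.univ : Finset Unit), finrank F (Xs.map (⊤ : Submodule F (A × E)).mkQ) = 0
    rw [finrank_map_mkQ_eq_zero_of_le le_top, Finset.sum_const_zero]

/-- **A transfer datum with prescribed dimensions exists iff the two crude inequalities hold** (the `→` half is
`TransferDatum.dimX_le_and_dimY_le`): given `a ≤ b + D` and `b ≤ a + D` the nested datum has `dimX = a`, `dimY = b` and
both budgets `≤ D`. [folklore] -/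
theorem exists_transferDatum_of_le_add (a b D : ℕ) (h₁ : a ≤ b + D) (h₂ : b ≤ a + D) :
    ∃ 𝓓 : TransferDatum F, 𝓓.dimX = a ∧ 𝓓.dimY = b ∧ 𝓓.budgetXY ≤ D ∧ 𝓓.budgetYX ≤ D := by
  rcases le_total a b with hab | hba
  · obtain ⟨e, rfl⟩ := Nat.exists_eq_add_of_le hab
    obtain ⟨𝓓, hX, hY, hXY, hYX⟩ := exists_transferDatum_small_large (F := F) a e
    exact ⟨𝓓, hX, hY, by omega, by omega⟩
  · obtain ⟨e, rfl⟩ := Nat.exists_eq_add_of_le hba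
    obtain ⟨𝓓, hX, hY, hXY, hYX⟩ := exists_transferDatum_large_small (F := F) b e
    exact ⟨𝓓, hX, hY, by omega, by omega⟩

end Audit

end SelmerTransfer

/-- **T27 ⟹ T27-REAL as typed** (AUDIT, x11b3-lead R17-5 (b)): the crude inequalities alone produce the abstract datum the
node asks for (nested coordinate subspaces over `𝔽₃`). Nothing arithmetic is used or claimed. [folklore] -/
theorem selmerPairRealisedThree_of_crude (h : CrudeSelmerTransferThree) : SelmerPairRealisedThree := by
  intro W G _ _ _ _ hirr hcong
  obtain ⟨h₁, h₂⟩ := h W G hirr hcong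
  exact SelmerTransfer.exists_transferDatum_of_le_add (F := ZMod 3) _ _ _ h₁ h₂

/-- **`SelmerPairRealisedThree ↔ CrudeSelmerTransferThree`** — the realisation node AS TYPED is equivalent to T27
(`→`: the landed `crudeSelmerTransferThree_of_realised`; `←`: `selmerPairRealisedThree_of_crude`). Both remain
`@[conjecture]` obligations; the re-typing of a realisation node with local-cohomology content is the typer's pen. [folklore] -/
theorem selmerPairRealisedThree_iff_crudeSelmerTransferThree : SelmerPairRealisedThree ↔ CrudeSelmerTransferThree :=
  ⟨crudeSelmerTransferThree_of_realised, selmerPairRealisedThree_of_crude⟩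

/-! ## §B The local lemmas L2 / L3 / L4 as algebraic cores -/

namespace SelmerTransfer

section FiniteGroup

/-- **Core of L3(ii) / L2 (finite part): `#ker g = #(M ⧸ g M)` for every endomorphism `g` of a FINITE abelian group `M`**
(both equal `#M / #g(M)`: first isomorphism theorem and Lagrange; the `R`-linear twin is the tree's
`Literature.Algebra.Module.natCard_ker_eq_natCard_quotient_range`). Reading: `g = φ − 1` gives `dim H⁰(ℚ_ℓ, M) =
dim H¹_ur(ℚ_ℓ, M)`; `g = 3` on a finite `T` gives `#T[3] = #(T/3T)`. [folklore] -/
theorem addMonoidHom_natCard_ker_eq_natCard_quotient_range {M : Type*} [AddCommGroup M] [Finite M] (g : M →+ M) :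
    Nat.card g.ker = Nat.card (M ⧸ g.range) := by
  have h1 := AddSubgroup.card_eq_card_quotient_mul_card_addSubgroup g.ker
  have h2 := AddSubgroup.card_eq_card_quotient_mul_card_addSubgroup g.range
  have h3 : Nat.card (M ⧸ g.ker) = Nat.card g.range :=
    Nat.card_congr (QuotientAddGroup.quotientKerEquivRange g).toEquiv
  have hpos : 0 < Nat.card g.range := Nat.card_pos
  rw [h3] at h1
  rw [h1, mul_comm (Nat.card (M ⧸ g.range))] at h2
  exact Nat.eq_of_mul_eq_mul_left hpos h2

/-- **L3(ii) core, Frobenius form: `#M^{φ = 1} = #(M ⧸ (φ − 1)M)`** for an endomorphism `φ` of a finite abelian group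
(`H⁰ = ker(φ − 1)` — membership is `φ m = m`, the tree's `SecondDescent.mem_ker_sub_id_iff` —, `H¹_ur = coker(φ − 1)` for
the procyclic group generated by Frobenius). [folklore] -/
theorem natCard_fixedBy_eq_natCard_coinvariants {M : Type*} [AddCommGroup M] [Finite M] (φ : M →+ M) :
    Nat.card (φ - AddMonoidHom.id M).ker = Nat.card (M ⧸ (φ - AddMonoidHom.id M).range) :=
  addMonoidHom_natCard_ker_eq_natCard_quotient_range _

/-- **L2 core, finite part: `#(T ⧸ 3T) = #T[3]`** for a finite abelian group `T` (the multiplication-by-`3` instance).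
[folklore] -/
theorem natCard_quotient_nsmul_eq_natCard_torsionBy {T : Type*} [AddCommGroup T] [Finite T] (n : ℕ) :
    Nat.card (T ⧸ (nsmulAddMonoidHom n : T →+ T).range) = Nat.card (nsmulAddMonoidHom n : T →+ T).ker :=
  (addMonoidHom_natCard_ker_eq_natCard_quotient_range _).symm

end FiniteGroup

section PadicPart

/-- **L2 core, free part (i): `ℤ₃[3] = 0`** — multiplication by `3` on `ℤ₃` is injective. [folklore] -/
theorem nsmul_three_ker_padicInt_eq_bot : (nsmulAddMonoidHom 3 : ℤ_[3] →+ ℤ_[3]).ker = ⊥ := by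
  rw [eq_bot_iff]
  intro x hx
  rw [AddMonoidHom.mem_ker, nsmulAddMonoidHom_apply, nsmul_eq_mul] at hx
  have h3 : ((3 : ℕ) : ℤ_[3]) ≠ 0 := by exact_mod_cast (show (3 : ℕ) ≠ 0 by norm_num)
  exact (AddSubgroup.mem_bot).mpr ((mul_eq_zero.mp hx).resolve_left h3)

/-- The range of multiplication by `3` on `ℤ₃` is (the additive group of) the maximal ideal `3ℤ₃ = ker (ℤ₃ → ℤ/3)`.
[folklore] -/
theorem nsmul_three_range_padicInt_eq :
    (nsmulAddMonoidHom 3 : ℤ_[3] →+ ℤ_[3]).range = (RingHom.ker (PadicInt.toZMod (p := 3))).toAddSubgroup := by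
  ext x
  rw [AddMonoidHom.mem_range, Submodule.mem_toAddSubgroup, PadicInt.ker_toZMod, PadicInt.maximalIdeal_eq_span_p,
    Ideal.mem_span_singleton']
  constructor
  · rintro ⟨y, rfl⟩
    exact ⟨y, by rw [nsmulAddMonoidHom_apply, nsmul_eq_mul, mul_comm]⟩
  · rintro ⟨y, rfl⟩
    exact ⟨y, by rw [nsmulAddMonoidHom_apply, nsmul_eq_mul, mul_comm]⟩

/-- **L2 core, free part (ii): `#(ℤ₃ ⧸ 3ℤ₃) = 3`** (`ℤ₃/3ℤ₃ ≅ ℤ/3` via `PadicInt.toZMod`). [folklore] -/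
theorem natCard_padicInt_quotient_three :
    Nat.card (ℤ_[3] ⧸ (nsmulAddMonoidHom 3 : ℤ_[3] →+ ℤ_[3]).range) = 3 := by
  rw [nsmul_three_range_padicInt_eq]
  have hs : Function.Surjective (PadicInt.toZMod (p := 3)).toAddMonoidHom :=
    ZMod.ringHom_surjective (PadicInt.toZMod (p := 3))
  have e := QuotientAddGroup.quotientKerEquivOfSurjective _ hs
  have hker : (PadicInt.toZMod (p := 3)).toAddMonoidHom.ker = (RingHom.ker (PadicInt.toZMod (p := 3))).toAddSubgroup := by
    ext x
    rfl
  rw [← hker, Nat.card_congr e.toEquiv, Nat.card_zmod]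

end PadicPart

section ProductBookkeeping

variable {A B : Type*} [AddCommGroup A] [AddCommGroup B]

/-- Multiplication by `n` on a product: its range is the product of the ranges. [folklore] -/
theorem nsmul_range_prod (n : ℕ) :
    (nsmulAddMonoidHom n : A × B →+ A × B).range =
      ((nsmulAddMonoidHom n : A →+ A).range).prod (nsmulAddMonoidHom n : B →+ B).range := by
  ext ⟨a, b⟩
  simp only [AddMonoidHom.mem_range, nsmulAddMonoidHom_apply, AddSubgroup.mem_prod, Prod.ext_iff, Prod.smul_fst,
    Prod.smul_snd]
  constructor
  · rintro ⟨⟨x, y⟩, hx, hy⟩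
    exact ⟨⟨x, hx⟩, ⟨y, hy⟩⟩
  · rintro ⟨⟨x, hx⟩, ⟨y, hy⟩⟩
    exact ⟨⟨x, y⟩, hx, hy⟩

/-- Multiplication by `n` on a product: its kernel is the product of the kernels. [folklore] -/
theorem nsmul_ker_prod (n : ℕ) :
    (nsmulAddMonoidHom n : A × B →+ A × B).ker =
      ((nsmulAddMonoidHom n : A →+ A).ker).prod (nsmulAddMonoidHom n : B →+ B).ker := by
  ext ⟨a, b⟩
  simp only [AddMonoidHom.mem_ker, nsmulAddMonoidHom_apply, AddSubgroup.mem_prod, Prod.ext_iff, Prod.smul_fst,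
    Prod.smul_snd, Prod.fst_zero, Prod.snd_zero]

/-- `#((A × B) ⧸ (H × K)) = #(A ⧸ H) · #(B ⧸ K)` (first isomorphism theorem for the product of the projections).
[folklore] -/
theorem natCard_quotient_prod (H : AddSubgroup A) (K : AddSubgroup B) :
    Nat.card ((A × B) ⧸ H.prod K) = Nat.card (A ⧸ H) * Nat.card (B ⧸ K) := by
  set f : A × B →+ (A ⧸ H) × (B ⧸ K) := (QuotientAddGroup.mk' H).prodMap (QuotientAddGroup.mk' K) with hf
  have hs : Function.Surjective f :=
    Function.Surjective.prodMap (QuotientAddGroup.mk'_surjective H) (QuotientAddGroup.mk'_surjective K)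
  have hker : f.ker = H.prod K := by
    rw [hf, AddMonoidHom.ker_prodMap, QuotientAddGroup.ker_mk', QuotientAddGroup.ker_mk']
  rw [← hker, Nat.card_congr (QuotientAddGroup.quotientKerEquivOfSurjective f hs).toEquiv, Nat.card_prod]

/-- `#(H × K) = #H · #K` for additive subgroups. [folklore] -/
theorem natCard_prod_addSubgroup (H : AddSubgroup A) (K : AddSubgroup B) :
    Nat.card (H.prod K) = Nat.card H * Nat.card K := by
  rw [Nat.card_congr (AddSubgroup.prodEquiv H K).toEquiv, Nat.card_prod]


/-- **L3(iii) core: `#(A/nA) = #A[n]` for `A = B × T` with `n` bijective on `B` and `T` finite.** Reading (the lane's,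
NOT claimed): for `ℓ ≠ 3`, `W(ℚ_ℓ) ≅ B ⊕ W(ℚ_ℓ)_tors` with `B` a pro-`ℓ` group on which `3` is invertible, so
`dim X_ℓ = dim W(ℚ_ℓ)/3 = dim W(ℚ_ℓ)[3] = h⁰_ℓ` — the bound `dim H¹_ur = dim X_ℓ = h⁰_ℓ` of T27-REAL's docstring. [folklore] -/
theorem natCard_quotient_nsmul_prod_of_bijective {T : Type*} [AddCommGroup T] [Finite T] (n : ℕ)
    (hB : Function.Bijective (nsmulAddMonoidHom n : A →+ A)) :
    Nat.card ((A × T) ⧸ (nsmulAddMonoidHom n : A × T →+ A × T).range) =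
      Nat.card (nsmulAddMonoidHom n : A × T →+ A × T).ker := by
  have hr : (nsmulAddMonoidHom n : A →+ A).range = ⊤ := AddMonoidHom.range_eq_top.mpr hB.2
  have hk : (nsmulAddMonoidHom n : A →+ A).ker = ⊥ := (AddMonoidHom.ker_eq_bot_iff _).mpr hB.1
  have h1 : Nat.card (A ⧸ (⊤ : AddSubgroup A)) = 1 := AddSubgroup.index_top
  rw [nsmul_range_prod, nsmul_ker_prod, natCard_quotient_prod, natCard_prod_addSubgroup, hr, hk, h1,
    AddSubgroup.card_bot, one_mul, one_mul, natCard_quotient_nsmul_eq_natCard_torsionBy]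

/-- **L2 core assembled: `#(A/3A) = 3 · #A[3]` for `A = ℤ₃ × T`, `T` a finite abelian group** — in `𝔽₃`-dimensions
`dim A/3A = 1 + dim A[3]`. Reading (the lane's, NOT claimed): `A = W(ℚ₃) ≅ ℤ₃ ⊕ W(ℚ₃)_tors`, `dim A[3] = h⁰₃ ≤ 1`, so
`dim X₃ = dim W(ℚ₃)/3 = 1 + h⁰₃`. [folklore] -/
theorem natCard_quotient_three_padicInt_prod {T : Type*} [AddCommGroup T] [Finite T] :
    Nat.card ((ℤ_[3] × T) ⧸ (nsmulAddMonoidHom 3 : ℤ_[3] × T →+ ℤ_[3] × T).range) =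
      3 * Nat.card (nsmulAddMonoidHom 3 : ℤ_[3] × T →+ ℤ_[3] × T).ker := by
  rw [nsmul_range_prod, nsmul_ker_prod, natCard_quotient_prod, natCard_prod_addSubgroup,
    natCard_padicInt_quotient_three, nsmul_three_ker_padicInt_eq_bot, AddSubgroup.card_bot, one_mul,
    natCard_quotient_nsmul_eq_natCard_torsionBy]

end ProductBookkeeping

section LinearCores

variable {F : Type*} [DivisionRing F] {V : Type*} [AddCommGroup V] [Module F V]

/-- **L3(ii) core, `finrank` form: `dim ker g = dim (V ⧸ g V)`** for an endomorphism of a finite-dimensional space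
(rank–nullity twice). [folklore] -/
theorem finrank_ker_eq_finrank_quotient_range [FiniteDimensional F V] (g : V →ₗ[F] V) :
    finrank F (LinearMap.ker g) = finrank F (V ⧸ LinearMap.range g) := by
  have h1 := LinearMap.finrank_range_add_finrank_ker g
  have h2 := Submodule.finrank_quotient_add_finrank (LinearMap.range g)
  omega

/-- **L3(i) core (a): quotienting by a LARGER subspace lowers the codimension count** — `U ≤ U'` gives
`dim X/(X ∩ U') ≤ dim X/(X ∩ U)` (the image of `X` in `V ⧸ U'` is the image of its image in `V ⧸ U`). Reading:
`U = im W₀(ℚ_ℓ)/3 ≤ H¹_ur = U'`. [folklore] -/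
theorem finrank_map_mkQ_anti (X U U' : Submodule F V) (h : U ≤ U') [FiniteDimensional F X] :
    finrank F (X.map U'.mkQ) ≤ finrank F (X.map U.mkQ) := by
  have hle : U ≤ U'.comap (LinearMap.id : V →ₗ[F] V) := by simpa using h
  have hmap : X.map U'.mkQ = (X.map U.mkQ).map (U.mapQ U' LinearMap.id hle) := by
    rw [← Submodule.map_comp, Submodule.mapQ_mkQ, Submodule.map_comp, Submodule.map_id]
  rw [hmap]
  exact Submodule.finrank_map_le _ _

/-- **L3(i) core (b): ONE extra generator costs at most one dimension** — if `X ≤ U ⊔ F∙x` then `dim X/(X ∩ U) ≤ 1`.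
Reading: `x` = the Kummer class of a generator of the cyclic 3-part of the component group `Φ_ℓ(𝔽_ℓ)`, so
`dim X_ℓ/(X_ℓ ∩ H¹_ur) ≤ [3 ∣ c_ℓ]`. [folklore] -/
theorem finrank_map_mkQ_le_one_of_le_sup_span (X U : Submodule F V) (x : V) (h : X ≤ U ⊔ F ∙ x)
    [FiniteDimensional F X] : finrank F (X.map U.mkQ) ≤ 1 := by
  have hle : X.map U.mkQ ≤ F ∙ (U.mkQ x) := by
    refine (Submodule.map_mono h).trans ?_
    rw [Submodule.map_sup, Submodule.mkQ_map_self, bot_sup_eq, Submodule.map_span, Set.image_singleton]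
  refine (Submodule.finrank_mono hle).trans ?_
  have := finrank_span_le_card (R := F) ({U.mkQ x} : Set (V ⧸ U))
  simpa using this

/-- **L4 core: two LINES that meet non-trivially coincide.** Reading: at a shared split node with `h⁰_ℓ = 1` both
Kummer lines `X_ℓ`, `Y_ℓ` (lines in the hyperbolic plane `H¹(ℚ_ℓ, ρ̄)`) contain the image of `H¹(ℚ_ℓ, μ₃)` (the toric
class, non-zero), hence `X_ℓ = Y_ℓ`. (Pointwise twin in the tree: `Literature.RepresentationTheory.FiniteGroups.
Representation.eq_of_finrank_eq_one_of_mem`.) [folklore] -/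
theorem eq_of_finrank_eq_one_of_inf_ne_bot [FiniteDimensional F V] {X Y : Submodule F V} (hX : finrank F X = 1)
    (hY : finrank F Y = 1) (h : X ⊓ Y ≠ ⊥) : X = Y := by
  obtain ⟨v, hv, hv0⟩ := (Submodule.ne_bot_iff _).mp h
  have hsp : finrank F (F ∙ v) = 1 := finrank_span_singleton hv0
  have hXe : (F ∙ v) = X :=
    Submodule.eq_of_le_of_finrank_eq ((Submodule.span_singleton_le_iff_mem v X).mpr hv.1) (by rw [hsp, hX])
  have hYe : (F ∙ v) = Y :=
    Submodule.eq_of_le_of_finrank_eq ((Submodule.span_singleton_le_iff_mem v Y).mpr hv.2) (by rw [hsp, hY])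
  rw [← hXe, ← hYe]

end LinearCores

end SelmerTransfer

end Summit.BirchSwinnertonDyer.Rank1Residual.O5

end
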